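import Summits.BirchSwinnertonDyer.BirchSwinnertonDyer.Theorems.GenusKolyvaginAtTwoMinimalTwinBSDTwoOddCutOfTranspositionWitness
import Summits.BirchSwinnertonDyer.BirchSwinnertonDyer.Theorems.GenusKolyvaginAtTwoDeepWitnessDefs
import HarnessLib

/-!
# Route `GenusKolyvaginAtTwo` — THE LOWER HALF FOR EVERY ANALYTIC-RANK-ONE HABITAT MEMBER, EITHER SIGN OF `Δ`, NO SELMER HYPOTHESIS:
# `4^{M₀} ∣ #Ш(W_K)[2^∞]` from ONE transposition-deep witness (Ш-cell 27477 / LINE 42 STRUCT₂′ on the whole habitat; U₂ 22985 LINE 23)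

Seat `bsd-line-gk2-p2` g32 (PROVER seat 2/3, cell `bsd-f1-sign2`, LINE 23 holder), `--supports stmt-BirchSwinnertonDyer-22985 --as helper`
(also serves stmt-BirchSwinnertonDyer-27477 by name).  THEOREMS ONLY (no definition, no named fact, no `sorry`).  BSD is NOT proved by any of this;
neither U₂ nor the Ш-cell; nothing is closed.

WHY (director-bsd (751)(3) alignment; LEAD gk2-p1 g32 05:27:56Z §3: «on the Ш-cell's `Δ < 0` habitat sub-cell STRUCT₂′ with the point-level witness is
CLOSED mod Q2 by L_T; the structure theorem at `2` is needed only off the habitat, on `Δ > 0` …»).  This seat's p811686 §1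
`pow_dvd_natCard_sha_baseChange_of_transpositionWitness_of_rank_le_one` is sign-free and root-number-free; its only rank input is `rank W(K) ≤ 1`.  For
ANY analytic-rank-one habitat member that input is PRINT + Q2: `rank W(ℚ) = 1` (GZK, item 19921 `MultPublishedInputsAtTwo` =
`rank_eq_analyticRank_of_analyticRank_le_one`) and `rank W^{(d_K)}(ℚ) = 0` (g31's `mordellWeilRank_twist_eq_zero_signFree`, Kolyvagin's Thm. B rank part
for the twin, `w(W) = −1` from `r_an(W) = 1`).  So the `Δ > 0` habitat sub-cell of the Ш-cell needs NO structure theorem either: one transposition-deep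
witness (the route's `K4Pos` clause) suffices, exactly as on `Δ < 0` one `Frob_∞`-deep witness (`HasDeepKolyvaginWitnessAtTwo`, p811931) does.

* §1 `mordellWeilRank_baseChange_le_one_of_analyticRank_one_signFree` — `rank W(K) ≤ 1` (indeed `= 1`-shaped inputs) for `r_an(W) = 1` on the habitat,
  either sign, mod Q2 + GZK; NO `#Sel₂` hypothesis (Ш-cell allowed).
* §2 `pow_dvd_natCard_sha_baseChange_of_transpositionWitness_of_analyticRank_one` — **`4^{M₀} ∣ #Ш(W_K)[2^∞]` for every analytic-rank-one habitat
  member at every odd Heegner frame `≠ ℚ(√−3)`, EITHER sign of `Δ`, from ONE transposition-deep witness**, mod Q2 + GZK.  (= LINE 42 STRUCT₂′'s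
  conclusion on the whole habitat, Ш-cell or not.)
* §3 `pow_dvd_natCard_sha_baseChange_of_hasDeepKolyvaginWitnessAtTwo_of_analyticRank_one` — the same on `Δ < 0` from the LEAD's NAMED witness
  `GenusExact.DeepWitness.HasDeepKolyvaginWitnessAtTwo W K Dt β ι` (p811931) via p811686 §6 (a `Frob_∞`-deep witness is transposition-deep on `Δ < 0`)
  — the by-name bridge between the (751)(3) name and the sign-free clause.

References: [Kolyvagin1991MathAnn] Thm. 2.1–2.2; [McCallumLMS1991] §5 Prop. 5.2, Thm. 5.4; [Kolyvagin1989Izv] Thm. B; [GrossLMS1991] §3 (3.2);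
[Darmon2004] Thm. 3.22 (GZK); [SilvermanAEC2009] Exercise 10.16.
-/

set_option autoImplicit false
set_option linter.dupNamespace false -- `Summit.<P>.<Sub>` repeats `BirchSwinnertonDyer` (D-0017)

noncomputable section

open scoped Classical

namespace Summit.BirchSwinnertonDyer.BirchSwinnertonDyer.Theorems.GenusExact.TwinSwap.TwinAnnihilation

open Literature.NumberTheory.EllipticCurves Literature.NumberTheory.GaloisRepresentations WeierstrassCurve NumberField
  IsDedekindDomain Field AddSubgroup Literature.NumberTheory.EllipticCurves.ModularForms
open Summit.BirchSwinnertonDyer.Rank1Residual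
open Summit.BirchSwinnertonDyer.BirchSwinnertonDyer.Theses.GenusKolyvaginAtTwo (KolyvaginRelationAtTwo)
open Summit.BirchSwinnertonDyer.BirchSwinnertonDyer.Theorems.GenusExact.DeepWitness (HasDeepKolyvaginWitnessAtTwo)

/-! ## §1 `rank W(K) ≤ 1` for an analytic-rank-one habitat member -/

/-- **`rank W(K) ≤ 1` for `r_an(W) = 1` on the habitat, EITHER SIGN of `Δ`, modulo Q2 + GZK, with NO Selmer hypothesis**: `rank W(K) = rank W(ℚ) +
rank W^{(d_K)}(ℚ)` (Silverman X.10.16); `rank W(ℚ) = r_an(W) = 1` by GZK; `rank W^{(d_K)}(ℚ) = 0` by g31's `mordellWeilRank_twist_eq_zero_signFree`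
(`w(W) = −1` from `r_an(W) = 1` by parity at the conductor level).  [cite: Darmon2004, Thm. 3.22] [cite: Kolyvagin1989Izv, Thm. B]
[cite: SilvermanAEC2009, Exercise 10.16, C.16] -/
theorem mordellWeilRank_baseChange_le_one_of_analyticRank_one_signFree (hQ2 : KolyvaginRelationAtTwo)
    (hGZK : rank_eq_analyticRank_of_analyticRank_le_one)
    (W : WeierstrassCurve ℚ) [W.IsElliptic] [W.IsGloballyMinimal] [NeZero (W.conductorNorm ℤ)] (hcm : ¬ W.HasCM) (hr : W.analyticRank = 1)
    (hT : Odd W.tamagawaProduct) (v : HeightOneSpectrum (𝓞 ℚ)) (h2v : ((2 : ℕ) : 𝓞 ℚ) ∉ v.asIdeal)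
    (hNv : ((W.conductorNorm ℤ : ℕ) : 𝓞 ℚ) ∈ v.asIdeal) (hmult : W.HasMultiplicativeReductionAt v)
    (K : Type) [Field K] [NumberField K] (hIQ : IsImaginaryQuadratic K) (hodd : Odd (NumberField.discr K))
    (h3 : NumberField.discr K ≠ -3) (hHe : SatisfiesHeegnerHypothesis (W.conductorNorm ℤ) K)
    (hsq1 : ¬ IsSquare ((NumberField.discr K : ℚ) * -|W.Δ|)) (hsq2 : ¬ IsSquare ((NumberField.discr K : ℚ) * (-(2 * |W.Δ|))))
    (hρ : ∀ n : ℕ, 0 < n → W.HasSurjectiveModNGaloisRep ((2 : ℤ) ^ n))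
    (Dt : ModularParametrizationData W (W.conductorNorm ℤ)) (β : ℤ) (ι : K →+* ℂ) (d₁ : KolyvaginHeegnerData Dt β ι 1) (M₀ : ℕ)
    (hndiv : ¬ ∃ Q : (W.baseChange (ringClassField K ι 1)).toAffine.Point, ((2 ^ (M₀ + 1) : ℕ) : ℤ) • Q = d₁.derivedPoint) :
    (W.baseChange K).mordellWeilRank ≤ 1 := by
  have hw : W.rootNumber = -1 := TwinSwapBit.rootNumber_eq_neg_one_of_analyticRank_eq_one W hr Dt
  have hdK0 : ((NumberField.discr K : ℤ) : ℚ) ≠ 0 := by exact_mod_cast NumberField.discr_ne_zero K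
  haveI hTell : (W.quadraticTwist ((NumberField.discr K : ℤ) : ℚ)).IsElliptic := W.isElliptic_quadraticTwist hdK0
  haveI hEK : (W.baseChange K).IsElliptic := inferInstanceAs ((W.map (algebraMap ℚ K)).IsElliptic)
  haveI : Module.Finite ℤ (W.baseChange K).toAffine.Point := (W.baseChange K).module_finite_point_holds
  have hsum := W.mordellWeilRank_baseChange_of_finrank_eq_two_of_finite K hIQ.1
  have hT0 := mordellWeilRank_twist_eq_zero_signFree hQ2 W hcm hT v h2v hNv hmult K hIQ hodd h3 hHe hsq1 hsq2 hρ Dt β ι d₁ M₀ hndiv hw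
  have hrk1 : W.mordellWeilRank = 1 := by
    have h := (hGZK W (by rw [hr])).1
    rw [h, hr]
  rw [hT0, add_zero, hrk1] at hsum
  rw [hsum]

/-! ## §2 The lower half for every analytic-rank-one habitat member, either sign -/

/-- **`4^{M₀} ∣ #Ш(W_K)[2^∞]` FOR EVERY ANALYTIC-RANK-ONE HABITAT MEMBER, EITHER SIGN OF `Δ`, from ONE TRANSPOSITION-deep witness**, modulo Q2 + GZK,
NO Selmer hypothesis (so it serves the Ш-cell 27477 as well as U₂): p811686 §1 fed by §1.  Frame: `W/ℚ` globally minimal, non-CM, `r_an = 1`, `C(W)`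
odd, an odd multiplicative prime, `ρ_{W,2^n}` onto; `K` odd `d_K ≠ −3` Heegner (the Theorem-B exclusions are automatic); `Dt`, `P(1)` of infinite order
with exact depth `M₀`; witness = the route's `K4Pos` clause (square-free `n₀`, every `ℓ ∣ n₀` Zhang–Kolyvagin-admissible at `2` of index `≥ 2` with an
arithmetic Frobenius moving a point of `W[2]`, `P(n₀) ∉ 2W(K[n₀])`).  CONDITIONAL; closes nothing; BSD is NOT proved.
[cite: Kolyvagin1991MathAnn, Thm. 2.1–2.2] [cite: McCallumLMS1991, §5 Prop. 5.2, Thm. 5.4] [cite: Darmon2004, Thm. 3.22] -/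
theorem pow_dvd_natCard_sha_baseChange_of_transpositionWitness_of_analyticRank_one (hQ2 : KolyvaginRelationAtTwo)
    (hGZK : rank_eq_analyticRank_of_analyticRank_le_one)
    (W : WeierstrassCurve ℚ) [W.IsElliptic] [W.IsGloballyMinimal] [NeZero (W.conductorNorm ℤ)] (hcm : ¬ W.HasCM) (hr : W.analyticRank = 1)
    (hT : Odd W.tamagawaProduct) (v : HeightOneSpectrum (𝓞 ℚ)) (h2v : ((2 : ℕ) : 𝓞 ℚ) ∉ v.asIdeal)
    (hNv : ((W.conductorNorm ℤ : ℕ) : 𝓞 ℚ) ∈ v.asIdeal) (hmult : W.HasMultiplicativeReductionAt v)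
    (K : Type) [Field K] [NumberField K] (hIQ : IsImaginaryQuadratic K) (hodd : Odd (NumberField.discr K))
    (h3 : NumberField.discr K ≠ -3) (hHe : SatisfiesHeegnerHypothesis (W.conductorNorm ℤ) K)
    (hρ : ∀ n : ℕ, 0 < n → W.HasSurjectiveModNGaloisRep ((2 : ℤ) ^ n))
    (Dt : ModularParametrizationData W (W.conductorNorm ℤ)) (β : ℤ) (ι : K →+* ℂ) (d₁ : KolyvaginHeegnerData Dt β ι 1)
    (hy : ¬ IsOfFinAddOrder d₁.derivedPoint) (M₀ : ℕ)
    (hdiv : ∃ Q : (W.baseChange (ringClassField K ι 1)).toAffine.Point, ((2 ^ M₀ : ℕ) : ℤ) • Q = d₁.derivedPoint)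
    (hndiv : ¬ ∃ Q : (W.baseChange (ringClassField K ι 1)).toAffine.Point, ((2 ^ (M₀ + 1) : ℕ) : ℤ) • Q = d₁.derivedPoint)
    (n₀ : ℕ) (e₀ : KolyvaginHeegnerData Dt β ι n₀) (hn₀ : Squarefree n₀)
    (hKoly : ∀ ℓ ∈ n₀.primeFactors, Zhang2014.IsKolyvaginPrime (W.conductorNorm ℤ) W K 2 ℓ ∧ 2 ≤ Zhang2014.kolyvaginIndex W 2 ℓ ∧
      ∃ (v : HeightOneSpectrum (𝓞 ℚ)) (𝔓 : Ideal (absIntegers (𝓞 ℚ) ℚ)) (h : absoluteGaloisGroup ℚ),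
        ((ℓ : ℕ) : 𝓞 ℚ) ∈ v.asIdeal ∧ 𝔓 ∈ v.primesAbove ∧ IsArithFrobAt (𝓞 ℚ) h 𝔓 ∧ ∃ u : W.geomTorsion ((2 : ℕ) : ℤ), h • u ≠ u)
    (he₀ : ¬ ∃ Q : (W.baseChange (ringClassField K ι n₀)).toAffine.Point, (2 : ℤ) • Q = e₀.derivedPoint) :
    2 ^ (2 * M₀) ∣ Nat.card (AddCommGroup.primaryComponent (W.baseChange K).sha 2) := by
  obtain ⟨hsq1, hsq2⟩ := kolyvaginExclusions_of_odd_of_satisfiesHeegnerHypothesis W hIQ hodd hHe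
  exact pow_dvd_natCard_sha_baseChange_of_transpositionWitness_of_rank_le_one hQ2 W hcm hT v h2v hNv hmult K hIQ hodd h3 hHe hsq1 hsq2 hρ Dt β ι d₁
    hy M₀ hdiv hndiv
    (mordellWeilRank_baseChange_le_one_of_analyticRank_one_signFree hQ2 hGZK W hcm hr hT v h2v hNv hmult K hIQ hodd h3 hHe hsq1 hsq2 hρ Dt β ι d₁
      M₀ hndiv)
    n₀ e₀ hn₀ hKoly he₀

/-! ## §3 The by-name bridge on `Δ < 0`: the LEAD's `HasDeepKolyvaginWitnessAtTwo` -/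

/-- **On `Δ < 0`, the NAMED deep witness `HasDeepKolyvaginWitnessAtTwo W K Dt β ι` (p811931, the (751)(3) pick: `Frob_∞`-deep primes) gives the
transposition-deep witness clause** (p811686 §6 under the name).  Pure bookkeeping. [cite: GrossLMS1991, §3 (3.2)] -/
theorem transpositionWitness_of_hasDeepKolyvaginWitnessAtTwo_of_Δ_neg
    (W : WeierstrassCurve ℚ) [W.IsElliptic] [W.IsGloballyMinimal] [NeZero (W.conductorNorm ℤ)] (hneg : W.Δ < 0)
    (K : Type) [Field K] [NumberField K] (Dt : ModularParametrizationData W (W.conductorNorm ℤ)) (β : ℤ) (ι : K →+* ℂ)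
    (hW : HasDeepKolyvaginWitnessAtTwo W K Dt β ι) :
    ∃ (n : ℕ) (d : KolyvaginHeegnerData Dt β ι n), Squarefree n ∧
      (∀ ℓ ∈ n.primeFactors, Zhang2014.IsKolyvaginPrime (W.conductorNorm ℤ) W K 2 ℓ ∧ 2 ≤ Zhang2014.kolyvaginIndex W 2 ℓ ∧
        ∃ (v : HeightOneSpectrum (𝓞 ℚ)) (𝔓 : Ideal (absIntegers (𝓞 ℚ) ℚ)) (h : absoluteGaloisGroup ℚ),
          ((ℓ : ℕ) : 𝓞 ℚ) ∈ v.asIdeal ∧ 𝔓 ∈ v.primesAbove ∧ IsArithFrobAt (𝓞 ℚ) h 𝔓 ∧ ∃ u : W.geomTorsion ((2 : ℕ) : ℤ), h • u ≠ u) ∧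
      ¬ ∃ Q : (W.baseChange (ringClassField K ι n)).toAffine.Point, (2 : ℤ) • Q = d.derivedPoint := by
  obtain ⟨n, d, hn, hdeep, hPn⟩ := hW
  exact ⟨n, d, hn, transpositionDeep_of_frobInftyDeep_of_Δ_neg W hneg K hdeep, hPn⟩

/-- **`4^{M₀} ∣ #Ш(W_K)[2^∞]` on the `Δ < 0` habitat for every analytic-rank-one member from the NAMED witness `HasDeepKolyvaginWitnessAtTwo`**, modulo
Q2 + GZK, NO Selmer hypothesis: §2 ∘ §3-bridge.  (On `Δ < 0` this is also the route's CLOSED L_T `powDvdShaCardAtTwoRT_proof` read by name, as the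
LEAD's alignment memo says; this version goes through road (E4)⁺ instead and needs GZK for the rank input.)  CONDITIONAL; closes nothing; BSD is
NOT proved. [cite: Kolyvagin1991MathAnn, Thm. 2.1–2.2] [cite: McCallumLMS1991, §5 Thm. 5.4] [cite: Darmon2004, Thm. 3.22] -/
theorem pow_dvd_natCard_sha_baseChange_of_hasDeepKolyvaginWitnessAtTwo_of_analyticRank_one (hQ2 : KolyvaginRelationAtTwo)
    (hGZK : rank_eq_analyticRank_of_analyticRank_le_one)
    (W : WeierstrassCurve ℚ) [W.IsElliptic] [W.IsGloballyMinimal] [NeZero (W.conductorNorm ℤ)] (hcm : ¬ W.HasCM) (hr : W.analyticRank = 1)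
    (hT : Odd W.tamagawaProduct) (v : HeightOneSpectrum (𝓞 ℚ)) (h2v : ((2 : ℕ) : 𝓞 ℚ) ∉ v.asIdeal)
    (hNv : ((W.conductorNorm ℤ : ℕ) : 𝓞 ℚ) ∈ v.asIdeal) (hmult : W.HasMultiplicativeReductionAt v) (hneg : W.Δ < 0)
    (K : Type) [Field K] [NumberField K] (hIQ : IsImaginaryQuadratic K) (hodd : Odd (NumberField.discr K))
    (h3 : NumberField.discr K ≠ -3) (hHe : SatisfiesHeegnerHypothesis (W.conductorNorm ℤ) K)
    (hρ : ∀ n : ℕ, 0 < n → W.HasSurjectiveModNGaloisRep ((2 : ℤ) ^ n))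
    (Dt : ModularParametrizationData W (W.conductorNorm ℤ)) (β : ℤ) (ι : K →+* ℂ) (d₁ : KolyvaginHeegnerData Dt β ι 1)
    (hy : ¬ IsOfFinAddOrder d₁.derivedPoint) (M₀ : ℕ)
    (hdiv : ∃ Q : (W.baseChange (ringClassField K ι 1)).toAffine.Point, ((2 ^ M₀ : ℕ) : ℤ) • Q = d₁.derivedPoint)
    (hndiv : ¬ ∃ Q : (W.baseChange (ringClassField K ι 1)).toAffine.Point, ((2 ^ (M₀ + 1) : ℕ) : ℤ) • Q = d₁.derivedPoint)
    (hW : HasDeepKolyvaginWitnessAtTwo W K Dt β ι) :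
    2 ^ (2 * M₀) ∣ Nat.card (AddCommGroup.primaryComponent (W.baseChange K).sha 2) := by
  obtain ⟨n, d, hn, hdeep, hPn⟩ := transpositionWitness_of_hasDeepKolyvaginWitnessAtTwo_of_Δ_neg W hneg K Dt β ι hW
  exact pow_dvd_natCard_sha_baseChange_of_transpositionWitness_of_analyticRank_one hQ2 hGZK W hcm hr hT v h2v hNv hmult K hIQ hodd h3 hHe hρ Dt β ι
    d₁ hy M₀ hdiv hndiv n d hn hdeep hPn

end Summit.BirchSwinnertonDyer.BirchSwinnertonDyer.Theorems.GenusExact.TwinSwap.TwinAnnihilation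

end
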